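import Summits.AtomisticToContinuum.HydrodynamicLimit.Theorems.JParityClosureRateFloorTubeBridge
import Literature.MathematicalPhysics.KineticTheory.CollisionTubePairMean
import HarnessLib

/-!
# Line `Sketch` of crux `RateFloor`, rung 0: the would-be marked sum of one window dominates a static decorated tube sum
# (helper file, `--supports stmt-AtomisticToContinuum-13080`)

The SURE per-window comparison of the rung-0 floor `stub_staticOpacityFloorRung0` (c2 lane).  Fix a configuration `z`
of `n` particles on `𝕋³ × ℝ³`, a window `(s, s + κε]`, the line's mark `F(u, x, y, v, w) = χ(u, x) Ξ(ε⁻¹ sepVec x y, v, w)`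
(`χ, Ξ ≥ 0`), a truncated mark `0 ≤ Ξ' ≤ Ξ` vanishing at relative speed `≥ 2L` and at speed `‖v‖ ≥ 2V`, and a
weight `χₜ ≥ 0` on `𝕋³` dominated along short flights of slow particles,
`χₜ(y) ≤ χ(s + t₁, y + t₁ v)` for `0 < t₁ ≤ κε`, `‖v‖ < 2V` (the consumer takes `χₜ = (χ(s, ·) − ω)₊` with a modulus
of continuity of `χ`).  If `ε (1 + 4κL) < 1/2` then

  `Σ_{i ≠ j} χₜ(xᵢ) · pairTubeMark ε κ Ξ' i j x v ≤ wouldBeSum ε (κε) z s F`     (`tubeSum_trunc_le_wouldBeSum`):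

a strict-tube pair with a nonvanishing truncated mark is slow, hence inside the chart
(`RateFloorTubeBridge.chart_of_smul_mem_strictTube`), hence a would-be pair of the line
(`mem_wouldBePairs_of_smul_mem_strictTube`) whose predicted impact datum IS the tube's impact normal
(`inv_smul_sepVec_freeFlight_firstContact`) and whose first contact time lies in `(0, κε]` (`firstContact_mem_Ioc`);
the remaining would-be terms are nonnegative.  The left side is the static decorated tube sum whose Gibbs mean and
variance are controlled in `Literature/…/CollisionTubePairMeanLowerBound`, `CollisionTubeVarianceStaticsSharp`.
-/

noncomputable section

open scoped BigOperators Classical InnerProductSpace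
open MeasureTheory Set
open Literature.Analysis.FluidPDE Literature.MathematicalPhysics.KineticTheory

namespace Summit.AtomisticToContinuum.HydrodynamicLimit.Theorems

namespace RateFloorWindowFloor

open RateFloorLine RateFloorTubeBridge

variable {n : ℕ}

/-- The pair tube mark read on a configuration is the tube mark of the rescaled minimal-image separation
`ε⁻¹ sepVec xᵢ xⱼ` and the two velocities. [folklore] -/
theorem pairTubeMark_config_eq (ε κ : ℝ) (Ξ : V3 × V3 × V3 → ℝ) (z : Config n (Fin 3) T3) (i j : Fin n) :
    pairTubeMark ε κ Ξ i j (fun m => (z m).1) (fun m => (z m).2) =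
      if ε⁻¹ • (Torus.geometry (Fin 3)).sepVec (z i).1 (z j).1 ∈ strictTube κ ((z i).2 - (z j).2) then
        Ξ (impactNormal ((z i).2 - (z j).2) (ε⁻¹ • (Torus.geometry (Fin 3)).sepVec (z i).1 (z j).1), (z i).2, (z j).2)
      else 0 := by
  simp only [pairTubeMark, tubeMark, Torus.geometry_sepVec]

/-- **The would-be marked sum of one window dominates the truncated static decorated tube sum** (see the module
docstring for the hypotheses). [folklore] -/
theorem tubeSum_trunc_le_wouldBeSum {ε κ L V : ℝ} (hε : 0 < ε) (hκ : 0 ≤ κ)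
    (hsmall : ε * (1 + 4 * κ * L) < 1 / 2) (z : Config n (Fin 3) T3) (s : ℝ)
    {χ : ℝ × T3 → ℝ} (hχ0 : ∀ p, 0 ≤ χ p) {Ξ Ξ' : V3 × V3 × V3 → ℝ} (hΞ0 : ∀ q, 0 ≤ Ξ q)
    (hΞ'le : ∀ q, Ξ' q ≤ Ξ q)
    (hΞ'L : ∀ m v v' : V3, 2 * L ≤ ‖v - v'‖ → Ξ' (m, v, v') = 0)
    (hΞ'V : ∀ m v v' : V3, 2 * V ≤ ‖v‖ → Ξ' (m, v, v') = 0)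
    {χt : T3 → ℝ} (hχt0 : ∀ y, 0 ≤ χt y)
    (hmod : ∀ (y : T3) (t₁ : ℝ) (v : V3), 0 < t₁ → t₁ ≤ κ * ε → ‖v‖ < 2 * V →
      χt y ≤ χ (s + t₁, (Torus.geometry (Fin 3)).translate y (t₁ • v))) :
    ∑ i : Fin n, ∑ j : Fin n,
        (if i ≠ j then χt (z i).1 * pairTubeMark ε κ Ξ' i j (fun m => (z m).1) (fun m => (z m).2) else 0) ≤
      wouldBeSum ε (κ * ε) z s
        (fun u x y v w => χ (u, x) * Ξ (ε⁻¹ • (Torus.geometry (Fin 3)).sepVec x y, v, w)) := by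
  set G := Torus.geometry (Fin 3) with hG
  set F : ℝ → T3 → T3 → V3 → V3 → ℝ := fun u x y v w => χ (u, x) * Ξ (ε⁻¹ • G.sepVec x y, v, w) with hF
  have hF0 : ∀ u x y v w, 0 ≤ F u x y v w := fun u x y v w => mul_nonneg (hχ0 _) (hΞ0 _)
  -- the predicted-datum term of an ordered pair
  set Ft : Fin n × Fin n → ℝ := fun p =>
    F (s + firstContact ε (κ * ε) z p) (freeFlight G (firstContact ε (κ * ε) z p) z p.1).1
      (freeFlight G (firstContact ε (κ * ε) z p) z p.2).1 (z p.1).2 (z p.2).2 with hFt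
  have hFt0 : ∀ p, 0 ≤ Ft p := fun p => hF0 _ _ _ _ _
  -- the slow strict-tube pairs inside the chart
  set W : Finset (Fin n × Fin n) := (Finset.univ ×ˢ Finset.univ).filter fun p =>
    p.1 ≠ p.2 ∧ ε⁻¹ • G.sepVec (z p.1).1 (z p.2).1 ∈ strictTube κ ((z p.1).2 - (z p.2).2) ∧
      ‖G.sepVec (z p.1).1 (z p.2).1‖ + κ * ε * ‖(z p.1).2 - (z p.2).2‖ < 1 / 2 with hW
  have hWsub : W ⊆ wouldBePairs ε (κ * ε) z := by
    intro p hp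
    simp only [hW, Finset.mem_filter, Finset.mem_product, Finset.mem_univ, true_and] at hp
    exact mem_wouldBePairs_of_smul_mem_strictTube hε hp.1 hp.2.2 hp.2.1
  -- termwise domination
  have hterm : ∀ i j : Fin n,
      (if i ≠ j then χt (z i).1 * pairTubeMark ε κ Ξ' i j (fun m => (z m).1) (fun m => (z m).2) else 0) ≤
        if (i, j) ∈ W then Ft (i, j) else 0 := by
    intro i j
    by_cases hij : i ≠ j
    · rw [if_pos hij, pairTubeMark_config_eq]
      by_cases hq : ε⁻¹ • G.sepVec (z i).1 (z j).1 ∈ strictTube κ ((z i).2 - (z j).2)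
      · rw [if_pos hq]
        by_cases hm : Ξ' (impactNormal ((z i).2 - (z j).2) (ε⁻¹ • G.sepVec (z i).1 (z j).1), (z i).2, (z j).2) = 0
        · rw [hm, mul_zero]
          split_ifs
          · exact hFt0 _
          · exact le_rfl
        · -- a nonvanishing truncated mark: the pair is slow, hence inside the chart, hence would-be
          have hwL : ‖(z i).2 - (z j).2‖ < 2 * L := by
            by_contra hc; exact hm (hΞ'L _ _ _ (not_lt.1 hc))
          have hvV : ‖(z i).2‖ < 2 * V := by
            by_contra hc; exact hm (hΞ'V _ _ _ (not_lt.1 hc))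
          have hsmall' : ε * (1 + 2 * κ * ‖(z i).2 - (z j).2‖) < 1 / 2 := by
            have : 2 * κ * ‖(z i).2 - (z j).2‖ ≤ 4 * κ * L := by nlinarith [norm_nonneg ((z i).2 - (z j).2)]
            have : ε * (1 + 2 * κ * ‖(z i).2 - (z j).2‖) ≤ ε * (1 + 4 * κ * L) := by nlinarith
            linarith
          have hchart := chart_of_smul_mem_strictTube hε hq hsmall'
          have hmemW : (i, j) ∈ W := by
            simp only [hW, Finset.mem_filter, Finset.mem_product, Finset.mem_univ, true_and]
            exact ⟨hij, hq, hchart⟩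
          rw [if_pos hmemW]
          -- the predicted datum
          have hfc := firstContact_mem_Ioc hε hchart hq
          have hn := inv_smul_sepVec_freeFlight_firstContact hε hchart hq
          have hFt_eq : Ft (i, j) = χ (s + firstContact ε (κ * ε) z (i, j),
              G.translate (z i).1 (firstContact ε (κ * ε) z (i, j) • (z i).2)) *
              Ξ (impactNormal ((z i).2 - (z j).2) (ε⁻¹ • G.sepVec (z i).1 (z j).1), (z i).2, (z j).2) := by
            simp only [hFt, hF]
            rw [hn]
            rfl
          rw [hFt_eq]
          have hχle := hmod (z i).1 (firstContact ε (κ * ε) z (i, j)) (z i).2 hfc.1 hfc.2 hvV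
          calc χt (z i).1 * Ξ' (impactNormal ((z i).2 - (z j).2) (ε⁻¹ • G.sepVec (z i).1 (z j).1), (z i).2, (z j).2)
              ≤ χt (z i).1 * Ξ (impactNormal ((z i).2 - (z j).2) (ε⁻¹ • G.sepVec (z i).1 (z j).1), (z i).2, (z j).2) :=
                mul_le_mul_of_nonneg_left (hΞ'le _) (hχt0 _)
            _ ≤ χ (s + firstContact ε (κ * ε) z (i, j),
                  G.translate (z i).1 (firstContact ε (κ * ε) z (i, j) • (z i).2)) *
                Ξ (impactNormal ((z i).2 - (z j).2) (ε⁻¹ • G.sepVec (z i).1 (z j).1), (z i).2, (z j).2) :=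
                mul_le_mul_of_nonneg_right hχle (hΞ0 _)
      · rw [if_neg hq, mul_zero]
        split_ifs
        · exact hFt0 _
        · exact le_rfl
    · rw [if_neg hij]
      split_ifs
      · exact hFt0 _
      · exact le_rfl
  -- summation
  calc ∑ i : Fin n, ∑ j : Fin n,
        (if i ≠ j then χt (z i).1 * pairTubeMark ε κ Ξ' i j (fun m => (z m).1) (fun m => (z m).2) else 0)
      ≤ ∑ i : Fin n, ∑ j : Fin n, (if (i, j) ∈ W then Ft (i, j) else 0) :=
        Finset.sum_le_sum fun i _ => Finset.sum_le_sum fun j _ => hterm i j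
    _ = ∑ p ∈ Finset.univ ×ˢ Finset.univ, (if p ∈ W then Ft p else 0) := by rw [← Finset.sum_product']
    _ = ∑ p ∈ W, Ft p := by
        rw [← Finset.sum_filter]
        congr 1
        ext p
        simp only [Finset.mem_filter, Finset.mem_product, Finset.mem_univ, true_and]
    _ ≤ ∑ p ∈ wouldBePairs ε (κ * ε) z, Ft p := Finset.sum_le_sum_of_subset_of_nonneg hWsub fun p _ _ => hFt0 p
    _ = wouldBeSum ε (κ * ε) z s F := by simp only [wouldBeSum, hFt, hG]

/-- Registered stub `stub_tubeSumTruncLeWouldBeSum` of crux stmt-AtomisticToContinuum-13080 (line `Sketch`, c2 lane): the closed form of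
`tubeSum_trunc_le_wouldBeSum`. -/
theorem stub_tubeSumTruncLeWouldBeSum : ∀ (n : ℕ) (ε κ L V : ℝ), 0 < ε → 0 ≤ κ → ε * (1 + 4 * κ * L) < 1 / 2 → ∀ (z : Config n (Fin 3) T3) (s : ℝ) (χ : ℝ × T3 → ℝ), (∀ p, 0 ≤ χ p) → ∀ (Ξ Ξ' : V3 × V3 × V3 → ℝ), (∀ q, 0 ≤ Ξ q) → (∀ q, Ξ' q ≤ Ξ q) → (∀ m v v' : V3, 2 * L ≤ ‖v - v'‖ → Ξ' (m, v, v') = 0) → (∀ m v v' : V3, 2 * V ≤ ‖v‖ → Ξ' (m, v, v') = 0) → ∀ (χt : T3 → ℝ), (∀ y, 0 ≤ χt y) → (∀ (y : T3) (t₁ : ℝ) (v : V3), 0 < t₁ → t₁ ≤ κ * ε → ‖v‖ < 2 * V → χt y ≤ χ (s + t₁, (Torus.geometry (Fin 3)).translate y (t₁ • v))) → (∑ i : Fin n, ∑ j : Fin n, (if i ≠ j then χt (z i).1 * pairTubeMark ε κ Ξ' i j (fun m => (z m).1) (fun m => (z m).2) else 0)) ≤ RateFloorLine.wouldBeSum ε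 (κ * ε) z s (fun u x y v w => χ (u, x) * Ξ (ε⁻¹ • (Torus.geometry (Fin 3)).sepVec x y, v, w)) :=
  fun _n _ε _κ _L _V hε hκ hsmall z s _χ hχ0 _Ξ _Ξ' hΞ0 hΞ'le hΞ'L hΞ'V _χt hχt0 hmod =>
    tubeSum_trunc_le_wouldBeSum hε hκ hsmall z s hχ0 hΞ0 hΞ'le hΞ'L hΞ'V hχt0 hmod

end RateFloorWindowFloor

end Summit.AtomisticToContinuum.HydrodynamicLimit.Theorems

end
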